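import Mathlib
import HarnessLib
import Summits.ValiantsHypothesis.ValiantsHypothesis.Theorems.LacunarySymmetroidMatrixDescartesProductPlusOneRowLawsKThreshold

/-!
# LINE (A) `product_plus_one` — the RATE-WINDOW CELL for every K: knees below the threshold, poles above it, never cost

Support `d : Fin (n+2) → ℕ` (`StrictMono d`), any number `m` of rows `f_j = Σ_l C (a j l) X^{d l}`, a pole-free window `(u,v)` (`0 < u`), a threshold `p : ℕ`,
`0 < p`.  THE MENU (per row, one of):
* COHERENT (all coefficients of one sign, at least two active letters, every two active letters within a `d`-window of width `≤ p`): single knees, pair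
  knees, MULTI-KNEES — no condition on roots (there are none);
* a binomial POLE with the bottom letter (`a₀·a_{l₀+1} < 0`, rate `d_{l₀+1} − d₀ ≥ p`) or on a pair of tail letters (`a_{i+1}a_{j+1} < 0`, rate `≥ p`),
  its one positive root outside `(u,v)`;
* a CLOUD (`a₀` of one sign, the tail of the other, some tail letter active, every active tail letter of rate `≥ p` over the bottom letter), the window
  left of its root (`a₀·f(v) > 0`).
THEN ★★ `rateWindowCellEveryK_wronskian_roots_le_two`: `W(∏_j f_j)` has AT MOST TWO roots in `(u,v)`, and ★★ `rateWindowCellEveryK_eulerNumerator_roots_le_three`: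
for every coupling `l₀`, `eulerNumerator d a l₀` (unfolded) has AT MOST THREE roots in `(u,v)`.  With `p = d 1 − d 0` this contains ✓ `slowKneeCellEveryKPairs_…`
(there the knees have rate exactly `p`); the pen's ORDER-2 REMARK (threshold between the fastest knee and the slowest pole) is the case typed here, with
multi-knee rows added by the coherent window law ✓ `rowPsiK3_coherent_law`.

Honest framing: ONE W-cell family (helper; every K); nothing closes a stub; the fast-knee cell (#19), `WronskianBudgetK3`, `OneChangeFloorK3`, `stub_classRowK3`,
`stub_polyLaw`, 18050 `MatrixDescartes`, Conjecture B are NOT proved; `VP ≠ VNP` NOT proved.  No definitions, no named facts.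
-/

set_option linter.dupNamespace false

namespace Summit.ValiantsHypothesis.ValiantsHypothesis.Theorems.LacunarySymmetroidMatrixDescartes

namespace ProductPlusOne

open Finset Set Polynomial
open scoped BigOperators Topology Polynomial

/-- Negating a row negates its values. [this file's lemma] -/
theorem eval_rowK_neg {K : ℕ} (d : Fin K → ℕ) (b : Fin K → ℝ) (w : ℝ) :
    (∑ l, C (-b l) * X ^ (d l) : ℝ[X]).eval w = -(∑ l, C (b l) * X ^ (d l) : ℝ[X]).eval w := by
  simp only [eval_finsetSum, eval_mul, eval_C, eval_pow, eval_X, neg_mul, Finset.sum_neg_distrib]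

/-- ★ **THE MENU ROW LAW at threshold `p`**: a menu row (coherent-in-a-window / binomial pole of rate `≥ p` with its root outside / cloud of rates `≥ p` left of
its root) has, on `(u,v)`, a non-vanishing stripped form and `p²ψ₁ < ψ₃`. [this file's theorem] -/
theorem rateWindowRow_law {n : ℕ} (d : Fin (n + 2) → ℕ) (hd : StrictMono d) (b : Fin (n + 2) → ℝ) {u v : ℝ} (hu : 0 < u) (p : ℕ)
    (hrowj :
      ((((∀ l, 0 ≤ b l) ∨ (∀ l, b l ≤ 0)) ∧ (∃ l l', l ≠ l' ∧ b l ≠ 0 ∧ b l' ≠ 0) ∧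
          (∀ l l', b l ≠ 0 → b l' ≠ 0 → d l' ≤ d l + p)) ∨
      (∃ l₀ : Fin (n + 1), (∀ l, l ≠ l₀ → b l.succ = 0) ∧ b 0 * b l₀.succ < 0 ∧ p ≤ d l₀.succ - d 0 ∧
          0 ≤ (∑ l, C (b l) * X ^ (d l) : ℝ[X]).eval u * (∑ l, C (b l) * X ^ (d l) : ℝ[X]).eval v) ∨
      (∃ i i' : Fin (n + 1), i < i' ∧ b 0 = 0 ∧ (∀ l, l ≠ i → l ≠ i' → b l.succ = 0) ∧ b i.succ * b i'.succ < 0 ∧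
          p ≤ d i'.succ - d i.succ ∧ 0 ≤ (∑ l, C (b l) * X ^ (d l) : ℝ[X]).eval u * (∑ l, C (b l) * X ^ (d l) : ℝ[X]).eval v) ∨
      ((∀ l : Fin (n + 1), b 0 * b l.succ ≤ 0) ∧ (∃ l : Fin (n + 1), b l.succ ≠ 0) ∧ (∀ l : Fin (n + 1), b l.succ ≠ 0 → p ≤ d l.succ - d 0) ∧
          0 < b 0 * (∑ l, C (b l) * X ^ (d l) : ℝ[X]).eval v)))
    {x : ℝ} (hx : x ∈ Ioo u v) :
    b 0 - ∑ l : Fin (n + 1), (-(b l.succ)) * x ^ (d l.succ - d 0) ≠ 0 ∧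
    (p : ℝ) ^ 2 * rowPsiK1 (fun l : Fin (n + 1) => d l.succ - d 0) (b 0) (fun l : Fin (n + 1) => -(b l.succ)) x
      < rowPsiK3 (fun l : Fin (n + 1) => d l.succ - d 0) (b 0) (fun l : Fin (n + 1) => -(b l.succ)) x := by
  have hx0 : 0 < x := hu.trans hx.1
  rcases hrowj with ⟨hsign, hact, hwin⟩ | ⟨l₀, hzero, hpole, hrate, hend⟩ | ⟨i, i', hii', hb0, hzero, hneg, hrate, hend⟩ |
    ⟨hopp, hne, hrate, h0v⟩
  · rcases hsign with hpos | hnp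
    · exact rowLawsAt_coherent d hd b p hpos hact hwin hx0
    · -- all coefficients `≤ 0`: flip the row
      have hpos' : ∀ l, 0 ≤ (fun l => -b l) l := fun l => by simp only; linarith [hnp l]
      have hact' : ∃ l l', l ≠ l' ∧ (fun l => -b l) l ≠ 0 ∧ (fun l => -b l) l' ≠ 0 := by
        obtain ⟨l, l', hll', hl, hl'⟩ := hact
        exact ⟨l, l', hll', neg_ne_zero.2 hl, neg_ne_zero.2 hl'⟩
      have hwin' : ∀ l l', (fun l => -b l) l ≠ 0 → (fun l => -b l) l' ≠ 0 → d l' ≤ d l + p := fun l l' hl hl' =>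
        hwin l l' (neg_ne_zero.1 hl) (neg_ne_zero.1 hl')
      exact (rowLawAt_neg_iff d b (p : ℝ) x).1 (rowLawsAt_coherent d hd (fun l => -b l) p hpos' hact' hwin' hx0)
  · exact rowLawsAt_single_pole d hd b hu p l₀ hzero hpole hrate hend hx
  · exact rowLawsAt_pair_pole d hd b hu p i i' hii' hb0 hzero hneg hrate hend hx
  · have hb0 : b 0 ≠ 0 := fun h => by rw [h, zero_mul] at h0v; exact lt_irrefl _ h0v
    rcases lt_or_gt_of_ne hb0 with hneg0 | hpos0
    · -- `b₀ < 0`: flip the row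
      have hfv : (∑ l, C (b l) * X ^ (d l) : ℝ[X]).eval v < 0 := by
        by_contra hcon
        push Not at hcon
        have := mul_nonpos_of_nonpos_of_nonneg hneg0.le hcon
        linarith
      have h0' : 0 < (fun l => -b l) 0 := by simp only; linarith
      have hle' : ∀ l : Fin (n + 1), (fun l => -b l) l.succ ≤ 0 := by
        intro l
        simp only [neg_nonpos]
        by_contra hcon
        push Not at hcon
        have := mul_pos_of_neg_of_neg hneg0 hcon
        linarith [hopp l]
      have hne' : ∃ l : Fin (n + 1), (fun l => -b l) l.succ ≠ 0 := by
        obtain ⟨l, hl⟩ := hne; exact ⟨l, neg_ne_zero.2 hl⟩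
      have hrate' : ∀ l : Fin (n + 1), (fun l => -b l) l.succ ≠ 0 → p ≤ d l.succ - d 0 := fun l hl => hrate l (neg_ne_zero.1 hl)
      have hvpos' : 0 < (∑ l, C ((fun l => -b l) l) * X ^ (d l) : ℝ[X]).eval v := by
        simp only
        rw [eval_rowK_neg d b v]; linarith
      have h := rowLawsAt_cloud d hd (fun l => -b l) hu p hle' hne' hrate' hvpos' hx
      exact (rowLawAt_neg_iff d b (p : ℝ) x).1 h
    · have hfv : 0 < (∑ l, C (b l) * X ^ (d l) : ℝ[X]).eval v := (mul_pos_iff_of_pos_left hpos0).1 h0v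
      have hle : ∀ l : Fin (n + 1), b l.succ ≤ 0 := by
        intro l
        by_contra hcon
        push Not at hcon
        have := mul_pos hpos0 hcon
        linarith [hopp l]
      exact rowLawsAt_cloud d hd b hu p hle hne hrate hfv hx

/-- ★★ **THE RATE-WINDOW CELL FOR EVERY K**: `W(∏_j f_j)` has AT MOST TWO roots in `(u,v)`. [this file's theorem] -/
theorem rateWindowCellEveryK_wronskian_roots_le_two {m n : ℕ} (d : Fin (n + 2) → ℕ) (hd : StrictMono d)
    (a : Fin m → Fin (n + 2) → ℝ) {u v : ℝ} (hu : 0 < u) (p : ℕ) (hp : 0 < p)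
    (hrow : ∀ j,
      ((((∀ l, 0 ≤ a j l) ∨ (∀ l, a j l ≤ 0)) ∧ (∃ l l', l ≠ l' ∧ a j l ≠ 0 ∧ a j l' ≠ 0) ∧
          (∀ l l', a j l ≠ 0 → a j l' ≠ 0 → d l' ≤ d l + p)) ∨
      (∃ l₀ : Fin (n + 1), (∀ l, l ≠ l₀ → a j l.succ = 0) ∧ a j 0 * a j l₀.succ < 0 ∧ p ≤ d l₀.succ - d 0 ∧
          0 ≤ (∑ l, C (a j l) * X ^ (d l) : ℝ[X]).eval u * (∑ l, C (a j l) * X ^ (d l) : ℝ[X]).eval v) ∨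
      (∃ i i' : Fin (n + 1), i < i' ∧ a j 0 = 0 ∧ (∀ l, l ≠ i → l ≠ i' → a j l.succ = 0) ∧ a j i.succ * a j i'.succ < 0 ∧
          p ≤ d i'.succ - d i.succ ∧ 0 ≤ (∑ l, C (a j l) * X ^ (d l) : ℝ[X]).eval u * (∑ l, C (a j l) * X ^ (d l) : ℝ[X]).eval v) ∨
      ((∀ l : Fin (n + 1), a j 0 * a j l.succ ≤ 0) ∧ (∃ l : Fin (n + 1), a j l.succ ≠ 0) ∧ (∀ l : Fin (n + 1), a j l.succ ≠ 0 → p ≤ d l.succ - d 0) ∧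
          0 < a j 0 * (∑ l, C (a j l) * X ^ (d l) : ℝ[X]).eval v))) :
    (((∏ j, ∑ l, C (a j l) * X ^ (d l) : ℝ[X]) * (X * derivative (X * derivative (∏ j, ∑ l, C (a j l) * X ^ (d l) : ℝ[X])))
        - (X * derivative (∏ j, ∑ l, C (a j l) * X ^ (d l) : ℝ[X])) ^ 2).roots.toFinset.filter (fun t => u < t ∧ t < v)).card ≤ 2 :=
  wronskianK_roots_le_two_of_rowLawsAt d hd a hu p hp fun j _ hx => rateWindowRow_law d hd (a j) hu p (hrow j) hx

/-- No menu row vanishes on the window. [this file's lemma] -/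
theorem rateWindowCellEveryK_eval_ne_zero {m n : ℕ} (d : Fin (n + 2) → ℕ) (hd : StrictMono d)
    (a : Fin m → Fin (n + 2) → ℝ) {u v : ℝ} (hu : 0 < u) (p : ℕ)
    (hrow : ∀ j,
      ((((∀ l, 0 ≤ a j l) ∨ (∀ l, a j l ≤ 0)) ∧ (∃ l l', l ≠ l' ∧ a j l ≠ 0 ∧ a j l' ≠ 0) ∧
          (∀ l l', a j l ≠ 0 → a j l' ≠ 0 → d l' ≤ d l + p)) ∨
      (∃ l₀ : Fin (n + 1), (∀ l, l ≠ l₀ → a j l.succ = 0) ∧ a j 0 * a j l₀.succ < 0 ∧ p ≤ d l₀.succ - d 0 ∧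
          0 ≤ (∑ l, C (a j l) * X ^ (d l) : ℝ[X]).eval u * (∑ l, C (a j l) * X ^ (d l) : ℝ[X]).eval v) ∨
      (∃ i i' : Fin (n + 1), i < i' ∧ a j 0 = 0 ∧ (∀ l, l ≠ i → l ≠ i' → a j l.succ = 0) ∧ a j i.succ * a j i'.succ < 0 ∧
          p ≤ d i'.succ - d i.succ ∧ 0 ≤ (∑ l, C (a j l) * X ^ (d l) : ℝ[X]).eval u * (∑ l, C (a j l) * X ^ (d l) : ℝ[X]).eval v) ∨
      ((∀ l : Fin (n + 1), a j 0 * a j l.succ ≤ 0) ∧ (∃ l : Fin (n + 1), a j l.succ ≠ 0) ∧ (∀ l : Fin (n + 1), a j l.succ ≠ 0 → p ≤ d l.succ - d 0) ∧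
          0 < a j 0 * (∑ l, C (a j l) * X ^ (d l) : ℝ[X]).eval v)))
    {x : ℝ} (hx : x ∈ Ioo u v) (j : Fin m) : (∑ l, C (a j l) * X ^ (d l) : ℝ[X]).eval x ≠ 0 := by
  have hd0 : ∀ l, d 0 ≤ d l := fun l => hd.monotone (Fin.zero_le l)
  have hx0 : 0 < x := hu.trans hx.1
  rw [eval_rowK_eq d hd0 (a j) x]
  exact mul_ne_zero (pow_ne_zero _ hx0.ne') (rateWindowRow_law d hd (a j) hu p (hrow j) hx).1

/-- ★★ **THE RATE-WINDOW CELL IN THE FLOOR'S CURRENCY**: for every coupling `l₀`, `eulerNumerator d a l₀` (unfolded) has AT MOST THREE zeros in `(u,v)`.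
[this file's theorem] -/
theorem rateWindowCellEveryK_eulerNumerator_roots_le_three {m n : ℕ} (d : Fin (n + 2) → ℕ) (hd : StrictMono d)
    (a : Fin m → Fin (n + 2) → ℝ) (l₀ : Fin (n + 2)) {u v : ℝ} (hu : 0 < u) (p : ℕ) (hp : 0 < p)
    (hrow : ∀ j,
      ((((∀ l, 0 ≤ a j l) ∨ (∀ l, a j l ≤ 0)) ∧ (∃ l l', l ≠ l' ∧ a j l ≠ 0 ∧ a j l' ≠ 0) ∧
          (∀ l l', a j l ≠ 0 → a j l' ≠ 0 → d l' ≤ d l + p)) ∨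
      (∃ l₀ : Fin (n + 1), (∀ l, l ≠ l₀ → a j l.succ = 0) ∧ a j 0 * a j l₀.succ < 0 ∧ p ≤ d l₀.succ - d 0 ∧
          0 ≤ (∑ l, C (a j l) * X ^ (d l) : ℝ[X]).eval u * (∑ l, C (a j l) * X ^ (d l) : ℝ[X]).eval v) ∨
      (∃ i i' : Fin (n + 1), i < i' ∧ a j 0 = 0 ∧ (∀ l, l ≠ i → l ≠ i' → a j l.succ = 0) ∧ a j i.succ * a j i'.succ < 0 ∧
          p ≤ d i'.succ - d i.succ ∧ 0 ≤ (∑ l, C (a j l) * X ^ (d l) : ℝ[X]).eval u * (∑ l, C (a j l) * X ^ (d l) : ℝ[X]).eval v) ∨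
      ((∀ l : Fin (n + 1), a j 0 * a j l.succ ≤ 0) ∧ (∃ l : Fin (n + 1), a j l.succ ≠ 0) ∧ (∀ l : Fin (n + 1), a j l.succ ≠ 0 → p ≤ d l.succ - d 0) ∧
          0 < a j 0 * (∑ l, C (a j l) * X ^ (d l) : ℝ[X]).eval v))) :
    ((∑ j, (∑ l, C (a j l * ((d l : ℝ) - d l₀)) * X ^ (d l)) * ∏ i ∈ Finset.univ.erase j, (∑ l, C (a i l) * X ^ (d l))
        : ℝ[X]).roots.toFinset.filter (fun t => u < t ∧ t < v)).card ≤ 3 := by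
  classical
  refine roots_Ioo_card_le_of_Icc _ 3 fun u' v' hu' hv' => ?_
  rcases lt_or_ge v' u' with hvu | huv'
  · have : ((∑ j, (∑ l, C (a j l * ((d l : ℝ) - d l₀)) * X ^ (d l)) * ∏ i ∈ Finset.univ.erase j, (∑ l, C (a i l) * X ^ (d l))
        : ℝ[X]).roots.toFinset.filter (fun t => u' ≤ t ∧ t ≤ v')) = ∅ :=
      Finset.filter_eq_empty_iff.2 fun t _ h => by linarith [h.1, h.2]
    rw [this]; simp
  have hu'0 : 0 < u' := hu.trans hu'
  have hP : ∀ t ∈ Set.Icc u' v', (∏ j, (∑ l, C (a j l) * X ^ (d l) : ℝ[X])).eval t ≠ 0 := by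
    intro t ht
    rw [eval_prod]
    exact Finset.prod_ne_zero_iff.2 fun j _ =>
      rateWindowCellEveryK_eval_ne_zero d hd a hu p hrow ⟨hu'.trans_le ht.1, ht.2.trans_lt hv'⟩ j
  have h1 := eulerNumerator_roots_Icc_le_wronskian_roots_add_one d a l₀ hu'0 hP
  have h2 := rateWindowCellEveryK_wronskian_roots_le_two d hd a hu p hp hrow
  have h3 : (((∏ j, ∑ l, C (a j l) * X ^ (d l) : ℝ[X]) * (X * derivative (X * derivative (∏ j, ∑ l, C (a j l) * X ^ (d l) : ℝ[X])))
            - (X * derivative (∏ j, ∑ l, C (a j l) * X ^ (d l) : ℝ[X])) ^ 2).roots.toFinset.filter (fun w => u' < w ∧ w < v')).card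
      ≤ (((∏ j, ∑ l, C (a j l) * X ^ (d l) : ℝ[X]) * (X * derivative (X * derivative (∏ j, ∑ l, C (a j l) * X ^ (d l) : ℝ[X])))
            - (X * derivative (∏ j, ∑ l, C (a j l) * X ^ (d l) : ℝ[X])) ^ 2).roots.toFinset.filter (fun t => u < t ∧ t < v)).card := by
    refine Finset.card_le_card fun t ht => ?_
    have ht' := Finset.mem_filter.1 ht
    exact Finset.mem_filter.2 ⟨ht'.1, hu'.trans ht'.2.1, ht'.2.2.trans hv'⟩
  omega

end ProductPlusOne

end Summit.ValiantsHypothesis.ValiantsHypothesis.Theorems.LacunarySymmetroidMatrixDescartes
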